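import Summits.ABC.ABC.Theorems.IsogenyGlueCongruencePolyHeightOfBoundedPrimes
import Summits.ABC.ABC.Theorems.PolyHeightOfBoundedPrimes.Negative.SplitBookkeeping

/-!
# `PolyHeightOfBoundedPrimes` (stmt-ABC-16006, crux B′) — line `Sketch` (card `archimedean-hall-split`):
the route's own TARGET already carries the Hall half

Position bookkeeping for the planners (lead c1, cycle 1). The line splits the consequent `H` of B′ into the
finite half `PolySzpiroΔ` and the Hall half `PolyHallΔ` (`|c₄|³ ≤ C·|Δ|^{σ'}` on semistable global minimal
models). Since `X = SemistableDegreeConjecture ⟹ P ⟹ H` (landed `polyHeight_of_polyDegree`, p102896) and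
`H ⟹` both halves (`Negative.split_of_polyHeight`, p122124):

* `stub_hallHalf_of_target` (registered) — `X → PolyHallΔ`: the route target implies a free-exponent Hall
  statement for the coprime pairs `(c₄, c₆)` of semistable curves; so re-scoping the height waypoint to the
  finite half moves the Hall content into the declared abc-strength residual `… → X`, not out of the route;
* `finiteHalf_of_target` — `X → PolySzpiroΔ`;
* `hallHalf_of_generalizedSzpiroBG`, `finiteHalf_of_generalizedSzpiroBG` — the same from the catalogued
  Bombieri–Gubler generalized Szpiro conjecture (`polyHeight_of_generalizedSzpiroBG`, p111354).

One-line compositions of landed theorems; CONDITIONAL (X and the B–G conjecture are open); nothing closes the item.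
-/

noncomputable section

-- single-conjunct summit ABC: the duplicate ABC.ABC is mandated (CONVENTIONS §2)
set_option linter.dupNamespace false

namespace Summit.ABC.ABC.Theorems.PolyHeightOfBoundedPrimes.HallSplit

open WeierstrassCurve
open Literature.NumberTheory.EllipticCurves
open Summit.ABC.ABC.Theses.IsogenyGlueCongruence

/-- **REGISTERED STUB `stub_hallHalf_of_target`: the route target `X` implies the Hall half** (`X → P` at
`ε = 1`, `P → H` = `polyHeight_of_polyDegree`, `H →` Hall half = `Negative.split_of_polyHeight`). [folklore] -/
theorem stub_hallHalf_of_target :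
    SemistableDegreeConjecture → ∃ σ C : ℝ, 0 ≤ σ ∧ ∀ (W : WeierstrassCurve ℚ) [W.IsElliptic]
      [W.IsGloballyMinimal] [NeZero (W.conductorNorm ℤ)], W.IsSemistable ℤ →
        ((|W.c₄| ^ 3 : ℚ) : ℝ) ≤ C * ((|W.Δ| : ℚ) : ℝ) ^ σ :=
  fun hX ↦ (Summit.ABC.ABC.Theorems.PolyHeightOfBoundedPrimes.Negative.split_of_polyHeight
    (polyHeight_of_polyDegree ⟨2 + 1, hX 1 one_pos⟩)).2

/-- **`X →` the finite half `PolySzpiroΔ`.** [folklore] -/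
theorem finiteHalf_of_target (hX : SemistableDegreeConjecture) :
    ∃ σ C : ℝ, ∀ (W : WeierstrassCurve ℚ) [W.IsElliptic] [W.IsGloballyMinimal]
      [NeZero (W.conductorNorm ℤ)], W.IsSemistable ℤ →
        ((|W.Δ| : ℚ) : ℝ) ≤ C * (W.conductorNorm ℤ : ℝ) ^ σ :=
  (Summit.ABC.ABC.Theorems.PolyHeightOfBoundedPrimes.Negative.split_of_polyHeight
    (polyHeight_of_polyDegree ⟨2 + 1, hX 1 one_pos⟩)).1

/-- **`GeneralizedSzpiroConjectureBG →` the Hall half** (through `polyHeight_of_generalizedSzpiroBG`, p111354).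
[cite: BombieriGubler2006, Conj. 12.5.11 (p. 431)] -/
theorem hallHalf_of_generalizedSzpiroBG (h : GeneralizedSzpiroConjectureBG) :
    ∃ σ C : ℝ, 0 ≤ σ ∧ ∀ (W : WeierstrassCurve ℚ) [W.IsElliptic] [W.IsGloballyMinimal]
      [NeZero (W.conductorNorm ℤ)], W.IsSemistable ℤ →
        ((|W.c₄| ^ 3 : ℚ) : ℝ) ≤ C * ((|W.Δ| : ℚ) : ℝ) ^ σ :=
  (Summit.ABC.ABC.Theorems.PolyHeightOfBoundedPrimes.Negative.split_of_polyHeight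
    (polyHeight_of_generalizedSzpiroBG h)).2

/-- **`GeneralizedSzpiroConjectureBG →` the finite half.** [cite: BombieriGubler2006, Conj. 12.5.11 (p. 431)] -/
theorem finiteHalf_of_generalizedSzpiroBG (h : GeneralizedSzpiroConjectureBG) :
    ∃ σ C : ℝ, ∀ (W : WeierstrassCurve ℚ) [W.IsElliptic] [W.IsGloballyMinimal]
      [NeZero (W.conductorNorm ℤ)], W.IsSemistable ℤ →
        ((|W.Δ| : ℚ) : ℝ) ≤ C * (W.conductorNorm ℤ : ℝ) ^ σ :=
  (Summit.ABC.ABC.Theorems.PolyHeightOfBoundedPrimes.Negative.split_of_polyHeight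
    (polyHeight_of_generalizedSzpiroBG h)).1

end Summit.ABC.ABC.Theorems.PolyHeightOfBoundedPrimes.HallSplit

end
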